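import Literature.Computability.AlgebraicComplexity.SlidingWindowSums
import Literature.Computability.AlgebraicComplexity.HomDepthFourUpperBound
import HarnessLib

/-!
# Sliding-window witness: closed-form upper and lower bounds for the measure

Topic `Literature/Computability/AlgebraicComplexity`; sequel of `SlidingWindowSums.lean`,
penultimate step of the discharge of
`Literature.Barriers.ValiantsHypothesis.DepthReductionChasmDepthFour` (Kumar–Saraf 2017,
Cor. 1.3). Both sides of the comparison of the proof of Kumar–Saraf's Thm. 8.10 are put in
closed real form for the sliding-window witness:

* `choose_add_le_pow_mul`, `sum_choose_range_le`, `numSubsetsLE_le_two_pow` — the binomial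
  bookkeeping of eq. (4.1) (`C(N, m+i) ≤ ((N-m)/m)^i C(N,m)`, `C(N, m) ≤ (A/(A-m))^{N-A} C(A,m)`);
* `pspDim_upper` — for a homogeneous depth-4 circuit `P` computing `swPoly` and a good copy
  selector `g` (Lemma 8.2, deterministic: `exists_good_selector`),
  `Φ_{𝒯,m}(swPoly|_{selVars g}) ≤ size(P) · 2^{2n/s+1} · (rs+1) ρ^{rs} θ^{b} · C(A, m)`;
* `Esum_le`, `Lsum_le'` — the closed forms of the pair sums (`ZeroWindowShapes.V_eq` with the
  bounds `FA_le`, `Q_le`, `F_le'` of `ZeroWindowStrings.lean`).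

## References

* M. Kumar, S. Saraf, *On the power of homogeneous depth 4 arithmetic circuits*, SIAM J. Comput.
  46 (2017) 336–387: Lemma 4.1, Lemma 8.2, Lemmas 8.3–8.9, Thm. 8.10 (eq. (4.1)).
-/

noncomputable section

open MvPolynomial

namespace Literature.Computability.AlgebraicComplexity

namespace SlidingWindow

open KumarSaraf GKKS ZeroWindow Finset

/-! ### Binomial bookkeeping -/

/-- `C(A + b, m) ≤ (A/(A-m))^b · C(A, m)` for `m < A` (adding elements to the ground set costs a
factor `≤ A/(A-m)` each). [cite: KumarSaraf2017, Lemma 3.6] -/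
theorem choose_add_le_pow_mul (A m : ℕ) (hmA : m < A) : ∀ b : ℕ,
    ((A + b).choose m : ℝ) ≤ ((A : ℝ) / ((A : ℝ) - m)) ^ b * A.choose m
  | 0 => by simp
  | b + 1 => by
    have ih := choose_add_le_pow_mul A m hmA b
    have hAm : (0 : ℝ) < (A : ℝ) - m := by
      have : ((m : ℕ) : ℝ) + 1 ≤ A := by exact_mod_cast hmA
      linarith
    have hid := Nat.choose_mul_succ_eq (A + b) m
    -- `C(A+b, m) (A+b+1) = C(A+b+1, m) (A+b+1-m)`
    have hid' : (((A + b).choose m : ℕ) : ℝ) * ((A : ℝ) + b + 1) =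
        (((A + b + 1).choose m : ℕ) : ℝ) * ((A : ℝ) + b + 1 - m) := by
      have h1 : ((A + b + 1 - m : ℕ) : ℝ) = (A : ℝ) + b + 1 - m := by
        rw [Nat.cast_sub (by omega)]; push_cast; ring
      rw [← h1]
      exact_mod_cast hid
    have hu : (0 : ℝ) < (A : ℝ) + b + 1 - m := by linarith [(Nat.cast_nonneg b : (0 : ℝ) ≤ b)]
    have hstep : (((A + (b + 1)).choose m : ℕ) : ℝ) ≤ ((A : ℝ) / ((A : ℝ) - m)) * (((A + b).choose m : ℕ) : ℝ) := by
      rw [show A + (b + 1) = A + b + 1 by ring]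
      have heq : (((A + b + 1).choose m : ℕ) : ℝ) = (((A + b).choose m : ℕ) : ℝ) *
          (((A : ℝ) + b + 1) / ((A : ℝ) + b + 1 - m)) := by
        rw [mul_div_assoc', eq_div_iff hu.ne', ← hid']
      have hratio : ((A : ℝ) + b + 1) / ((A : ℝ) + b + 1 - m) ≤ (A : ℝ) / ((A : ℝ) - m) := by
        rw [div_le_div_iff₀ hu hAm]
        nlinarith [(Nat.cast_nonneg b : (0 : ℝ) ≤ b), (Nat.cast_nonneg m : (0 : ℝ) ≤ m)]
      rw [heq, mul_comm ((A : ℝ) / ((A : ℝ) - m))]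
      exact mul_le_mul_of_nonneg_left hratio (Nat.cast_nonneg _)
    calc (((A + (b + 1)).choose m : ℕ) : ℝ) ≤ ((A : ℝ) / ((A : ℝ) - m)) * (((A + b).choose m : ℕ) : ℝ) := hstep
      _ ≤ ((A : ℝ) / ((A : ℝ) - m)) * (((A : ℝ) / ((A : ℝ) - m)) ^ b * A.choose m) :=
          mul_le_mul_of_nonneg_left ih (div_nonneg (Nat.cast_nonneg _) hAm.le)
      _ = _ := by rw [pow_succ]; ring

/-- `C(N, m + i) ≤ ((N-m)/(m+1))^i · C(N, m)`. [cite: KumarSaraf2017, Lemma 3.6] -/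
theorem choose_add_right_le_pow_mul (N m : ℕ) : ∀ i : ℕ,
    (N.choose (m + i) : ℝ) ≤ (((N : ℝ) - m) / ((m : ℝ) + 1)) ^ i * N.choose m
  | 0 => by simp
  | i + 1 => by
    have ih := choose_add_right_le_pow_mul N m i
    have hm1 : (0 : ℝ) < (m : ℝ) + 1 := by linarith [(Nat.cast_nonneg m : (0 : ℝ) ≤ m)]
    by_cases hN : m + i + 1 ≤ N
    · have hid := Nat.choose_succ_right_eq N (m + i)
      -- `C(N, m+i+1) (m+i+1) = C(N, m+i) (N-m-i)`
      have hid' : ((N.choose (m + i + 1) : ℕ) : ℝ) * ((m : ℝ) + i + 1) =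
          ((N.choose (m + i) : ℕ) : ℝ) * ((N : ℝ) - m - i) := by
        have h1 : ((N - (m + i) : ℕ) : ℝ) = (N : ℝ) - m - i := by
          rw [Nat.cast_sub (by omega)]; push_cast; ring
        rw [← h1]
        exact_mod_cast hid
      have hu : (0 : ℝ) < (m : ℝ) + i + 1 := by linarith [(Nat.cast_nonneg i : (0 : ℝ) ≤ i)]
      have hstep : ((N.choose (m + (i + 1)) : ℕ) : ℝ) ≤
          (((N : ℝ) - m) / ((m : ℝ) + 1)) * ((N.choose (m + i) : ℕ) : ℝ) := by
        rw [show m + (i + 1) = m + i + 1 by ring]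
        have heq : ((N.choose (m + i + 1) : ℕ) : ℝ) = ((N.choose (m + i) : ℕ) : ℝ) *
            (((N : ℝ) - m - i) / ((m : ℝ) + i + 1)) := by
          rw [mul_div_assoc', eq_div_iff hu.ne', ← hid']
        have hratio : ((N : ℝ) - m - i) / ((m : ℝ) + i + 1) ≤ ((N : ℝ) - m) / ((m : ℝ) + 1) := by
          rw [div_le_div_iff₀ hu hm1]
          have hNm : ((m : ℕ) : ℝ) + i + 1 ≤ N := by exact_mod_cast hN
          nlinarith [(Nat.cast_nonneg i : (0 : ℝ) ≤ i), (Nat.cast_nonneg m : (0 : ℝ) ≤ m)]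
        rw [heq, mul_comm (((N : ℝ) - m) / ((m : ℝ) + 1))]
        exact mul_le_mul_of_nonneg_left hratio (Nat.cast_nonneg _)
      calc ((N.choose (m + (i + 1)) : ℕ) : ℝ) ≤ (((N : ℝ) - m) / ((m : ℝ) + 1)) * ((N.choose (m + i) : ℕ) : ℝ) := hstep
        _ ≤ (((N : ℝ) - m) / ((m : ℝ) + 1)) * ((((N : ℝ) - m) / ((m : ℝ) + 1)) ^ i * N.choose m) := by
            refine mul_le_mul_of_nonneg_left ih (div_nonneg ?_ hm1.le)
            have : ((m : ℕ) : ℝ) ≤ N := by exact_mod_cast (show m ≤ N by omega)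
            linarith
        _ = _ := by rw [pow_succ]; ring
    · -- beyond `N`: the binomial vanishes
      rw [Nat.choose_eq_zero_of_lt (by omega), Nat.cast_zero]
      by_cases hmN : m ≤ N
      · refine mul_nonneg (pow_nonneg (div_nonneg ?_ hm1.le) _) (Nat.cast_nonneg _)
        have : ((m : ℕ) : ℝ) ≤ N := by exact_mod_cast hmN
        linarith
      · rw [Nat.choose_eq_zero_of_lt (by omega), Nat.cast_zero, mul_zero]

/-- **`∑_{i ≤ k} C(N, m+i) ≤ (k+1) ρ^k C(N, m)`** with `ρ = (N-m)/m ≥ 1` (`0 < m`, `2m ≤ N`).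
[cite: KumarSaraf2017, Lemma 4.1] -/
theorem sum_choose_range_le (N m k : ℕ) (hm : 0 < m) (h2m : 2 * m ≤ N) :
    (∑ i ∈ Finset.range (k + 1), (N.choose (m + i) : ℝ)) ≤
      (k + 1) * (((N : ℝ) - m) / m) ^ k * N.choose m := by
  have hm0 : (0 : ℝ) < m := by exact_mod_cast hm
  have hρ1 : 1 ≤ ((N : ℝ) - m) / m := by
    rw [le_div_iff₀ hm0]
    have : (2 : ℝ) * m ≤ N := by exact_mod_cast h2m
    linarith
  have hρ' : ((N : ℝ) - m) / ((m : ℝ) + 1) ≤ ((N : ℝ) - m) / m :=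
    div_le_div_of_nonneg_left (by linarith [(le_div_iff₀ hm0).1 hρ1]) hm0 (by linarith)
  calc (∑ i ∈ Finset.range (k + 1), (N.choose (m + i) : ℝ))
      ≤ ∑ i ∈ Finset.range (k + 1), (((N : ℝ) - m) / m) ^ k * N.choose m := by
        refine Finset.sum_le_sum fun i hi => ?_
        rw [Finset.mem_range] at hi
        calc ((N.choose (m + i) : ℕ) : ℝ) ≤ (((N : ℝ) - m) / ((m : ℝ) + 1)) ^ i * N.choose m :=
              choose_add_right_le_pow_mul N m i
          _ ≤ (((N : ℝ) - m) / m) ^ i * N.choose m :=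
              mul_le_mul_of_nonneg_right (pow_le_pow_left₀ (div_nonneg (by
                linarith [(le_div_iff₀ hm0).1 hρ1]) (by linarith)) hρ' i) (Nat.cast_nonneg _)
          _ ≤ (((N : ℝ) - m) / m) ^ k * N.choose m :=
              mul_le_mul_of_nonneg_right (pow_le_pow_right₀ hρ1 (by omega)) (Nat.cast_nonneg _)
    _ = (k + 1) * (((N : ℝ) - m) / m) ^ k * N.choose m := by
        rw [Finset.sum_const, Finset.card_range, nsmul_eq_mul]; push_cast; ring

/-- `#{A ⊆ [l] : |A| ≤ r} ≤ 2^l`. [folklore] -/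
theorem numSubsetsLE_le_two_pow (l r : ℕ) : numSubsetsLE l r ≤ 2 ^ l := by
  unfold numSubsetsLE
  calc ((Finset.univ : Finset (Finset (Fin l))).filter fun A => A.card ≤ r).card
      ≤ (Finset.univ : Finset (Finset (Fin l))).card := Finset.card_filter_le _ _
    _ = 2 ^ l := by rw [Finset.card_univ, Fintype.card_finset, Fintype.card_fin]

/-! ### The upper bound for a circuit computing `swPoly` -/

variable {n t B r : ℕ} {K : Type*} [Field K]

/-- **Kumar–Saraf 2017, eq. (4.1) for the sliding-window witness, closed form**: if the homogeneous
depth-4 circuit `P` computes `swPoly K n t B` (`n ≥ 2`) and `g` is a copy selector under which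
every bottom monomial with all variables selected has support `≤ s` (`s ≥ 1`), then for the
derivatives `∂_{wv}` at any sites and `0 < m`, `2m ≤ N`, `m < N - b` (`b = n - r`):
`Φ_{𝒯,m}(swPoly|_{selVars g}) ≤ size(P) · 2^{2n/s+1} · ((rs+1) ρ^{rs}) · ((A/(A-m))^{b} C(A, m))`,
`ρ = (N-m)/m`, `A = N - b`. [cite: KumarSaraf2017, Thm. 8.10 (4.1)] -/
theorem pspDim_upper {P : ArithCircuit K (Var n t B)} (hc : P.Computes (swPoly K n t B))
    (h4 : P.IsDepthFour) (hh : P.IsHomogeneousCircuit) (hn : 2 ≤ n)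
    (g : Fin n → Win t → Fin (B + 1)) {s : ℕ} (hs : 1 ≤ s)
    (hV : ∀ e ∈ P.monoExps, e.support ⊆ selVars g → e.support.card ≤ s)
    (site : Fin r → Fin n) (m : ℕ) (hm0 : 0 < m) (h2m : 2 * m ≤ Fintype.card (Var n t B))
    (hmA : m < Fintype.card (Var n t B) - (n - r)) :
    (pspDim (Ls g site) m (restrictVars (selVars g) (swPoly K n t B)) : ℝ) ≤
      P.size * 2 ^ (2 * n / s + 1) *
        ((r * s + 1) * (((Fintype.card (Var n t B) : ℝ) - m) / m) ^ (r * s)) *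
        ((((Fintype.card (Var n t B) - (n - r) : ℕ) : ℝ) /
            (((Fintype.card (Var n t B) - (n - r) : ℕ) : ℝ) - m)) ^ (n - r) *
          ((Fintype.card (Var n t B) - (n - r)).choose m : ℕ)) := by
  classical
  set N := Fintype.card (Var n t B) with hN
  set b := n - r with hb
  set A := N - b with hA
  have hbase := pspDim_restrict_le hc h4 hh (swPoly_isHomogeneous K n t B) hn (selVars g) hs hV
    (Ls g site) r (fun wv => length_Ls wv) m
  have h1 : (pspDim (Ls g site) m (restrictVars (selVars g) (swPoly K n t B)) : ℝ) ≤
      P.size * ((numSubsetsLE (2 * n / s + 1) r : ℝ) *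
        ∑ i ∈ Finset.range (r * s + 1), (N.choose (m + i) : ℝ)) := by
    exact_mod_cast hbase
  have h2 : (numSubsetsLE (2 * n / s + 1) r : ℝ) ≤ 2 ^ (2 * n / s + 1) := by
    exact_mod_cast numSubsetsLE_le_two_pow _ _
  have h3 := sum_choose_range_le N m (r * s) hm0 h2m
  push_cast at h3
  have h4' : ((N.choose m : ℕ) : ℝ) ≤ ((A : ℝ) / ((A : ℝ) - m)) ^ b * (A.choose m : ℕ) := by
    have hNA : N = A + b := by omega
    rw [hNA]
    exact choose_add_le_pow_mul A m (by omega) b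
  have hsum0 : (0 : ℝ) ≤ ∑ i ∈ Finset.range (r * s + 1), (N.choose (m + i) : ℝ) :=
    Finset.sum_nonneg fun _ _ => Nat.cast_nonneg _
  have hρ0 : (0 : ℝ) ≤ ((N : ℝ) - m) / m := div_nonneg (by
    have : (2 : ℝ) * m ≤ N := by exact_mod_cast h2m
    linarith [(Nat.cast_nonneg m : (0 : ℝ) ≤ m)]) (Nat.cast_nonneg _)
  calc (pspDim (Ls g site) m (restrictVars (selVars g) (swPoly K n t B)) : ℝ)
      ≤ P.size * ((numSubsetsLE (2 * n / s + 1) r : ℝ) *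
          ∑ i ∈ Finset.range (r * s + 1), (N.choose (m + i) : ℝ)) := h1
    _ ≤ P.size * ((2 : ℝ) ^ (2 * n / s + 1) *
          ((r * s + 1) * (((N : ℝ) - m) / m) ^ (r * s) * N.choose m)) := by
        refine mul_le_mul_of_nonneg_left (mul_le_mul h2 h3 hsum0 (by positivity)) (Nat.cast_nonneg _)
    _ ≤ P.size * ((2 : ℝ) ^ (2 * n / s + 1) *
          ((r * s + 1) * (((N : ℝ) - m) / m) ^ (r * s) *
            (((A : ℝ) / ((A : ℝ) - m)) ^ b * (A.choose m : ℕ)))) := by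
        refine mul_le_mul_of_nonneg_left (mul_le_mul_of_nonneg_left
          (mul_le_mul_of_nonneg_left h4' (by positivity)) (by positivity)) (Nat.cast_nonneg _)
    _ = _ := by ring

/-! ### Closed forms of the pair sums -/

/-- `Q ≥ 0`. [folklore] -/
theorem Q_nonneg {θ : ℝ} (hθ : 0 ≤ θ) (t L : ℕ) : 0 ≤ Q θ t L :=
  strSum_nonneg fun _ => pow_nonneg hθ _

/-- **`E(x) ≤ x^n · θ · (2μ^d/(μ-θ)) · (θ · 3μ^{a'}/(μ-θ)²)^k · (2μ^{L'}/(μ-θ))`** for the sites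
`siteOf d`, `r = k + 1`, `n + t = d + (t+1) + (k d + L')` (`a' = d - t - 1`, `θ = x⁻¹`,
`μ = 2(1+η)`), under the hypotheses of `ZeroWindow.F_le` and the two absorption conditions
`θ^{a'+min(a',t)} ≤ μ^{a'}/(μ-θ)²`, `a' θ^{a'-1} ≤ μ^{a'}/(μ-θ)²`, and `μ - θ ≤ 1`.
[cite: KumarSaraf2017, Lemmas 8.3–8.4] -/
theorem Esum_le {d k L' : ℕ} (hd0 : 0 < d) (hdr : d * (k + 1) < n) (hd : 2 * t + 1 ≤ d)
    (hnt : n + t = d + (t + 1) + (k * d + L')) {x η : ℝ} (hx : 0 < x) (hx1 : x ≤ 1)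
    (hη0 : 0 < η) (hη : η ≤ 1 / 2) (hθμ : x⁻¹ < 2 * (1 + η))
    (hcond : 6 ≤ (2 * (1 + η) - x⁻¹) * η * x⁻¹ ^ t) (hgap : 2 * (1 + η) - x⁻¹ ≤ 1)
    (hC1 : x⁻¹ ^ (d - t - 1 + min (d - t - 1) t) ≤ (2 * (1 + η)) ^ (d - t - 1) / (2 * (1 + η) - x⁻¹) ^ 2)
    (hC2 : (d - t - 1 : ℕ) * x⁻¹ ^ (d - t - 1 - 1) ≤ (2 * (1 + η)) ^ (d - t - 1) / (2 * (1 + η) - x⁻¹) ^ 2) :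
    Esum t (siteOf (r := k + 1) d hdr) x ≤
      x ^ n * (x⁻¹ * (2 * (2 * (1 + η)) ^ d / (2 * (1 + η) - x⁻¹)) *
        ((x⁻¹ * (3 * (2 * (1 + η)) ^ (d - t - 1) / (2 * (1 + η) - x⁻¹) ^ 2)) ^ k *
          (2 * (2 * (1 + η)) ^ L' / (2 * (1 + η) - x⁻¹)))) := by
  set θ : ℝ := x⁻¹ with hθ
  set μ : ℝ := 2 * (1 + η) with hμ
  have hθ1 : 1 ≤ θ := by rw [hθ]; exact one_le_inv₀ hx |>.2 hx1
  have hθ0 : 0 ≤ θ := by linarith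
  have hgap0 : 0 < μ - θ := by rw [hμ]; linarith
  rw [Esum_siteOf_eq hd0 hdr hx, hnt, V_eq θ hd]
  -- the three factor bounds
  have hFA : ∀ L, FA θ t L ≤ 2 * μ ^ L / (μ - θ) := by
    intro L
    refine (FA_le hθ1 hη0 hη hθμ t hcond L).trans ?_
    have h1 : θ ^ L ≤ μ ^ L := pow_le_pow_left₀ hθ0 hθμ.le L
    have h2 : μ ^ L ≤ μ ^ L / (μ - θ) := by
      rw [le_div_iff₀ hgap0]
      exact mul_le_of_le_one_right (pow_nonneg (by linarith) _) hgap
    rw [hμ] at h1 h2 ⊢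
    rw [mul_div_assoc]
    linarith
  have hQ : Q θ t (d - t - 1) ≤ 3 * μ ^ (d - t - 1) / (μ - θ) ^ 2 := by
    refine (Q_le hθ1 hη0 hη hθμ t hcond (d - t - 1)).trans ?_
    rw [hμ] at hC1 hC2 ⊢
    rw [mul_div_assoc]
    linarith
  have hμ0 : 0 ≤ μ := by rw [hμ]; linarith
  -- monotone assembly
  have hFAd0 : 0 ≤ FA θ t d := FA_nonneg hθ0 t d
  have hFAL0 : 0 ≤ FA θ t L' := FA_nonneg hθ0 t L'
  have hQ0 : 0 ≤ Q θ t (d - t - 1) := Q_nonneg hθ0 t _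
  have hxn : 0 ≤ x ^ n := pow_nonneg hx.le n
  refine mul_le_mul_of_nonneg_left ?_ hxn
  refine mul_le_mul (mul_le_mul_of_nonneg_left (hFA d) hθ0) ?_ (mul_nonneg (pow_nonneg
    (mul_nonneg hθ0 hQ0) k) hFAL0) (mul_nonneg hθ0 (div_nonneg (by positivity) hgap0.le))
  exact mul_le_mul (pow_le_pow_left₀ (mul_nonneg hθ0 hQ0) (mul_le_mul_of_nonneg_left hQ hθ0) k)
    (hFA L') hFAL0 (pow_nonneg (mul_nonneg hθ0 (div_nonneg (by positivity) (sq_nonneg _))) k)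

/-- **`Λ(x) ≤ (1-x)^{n-r} · ((1-x)⁻¹ (1+ε))^{n+t}`** under the hypotheses of `ZeroWindow.F_le'`
for `θ₂ = (1-x)⁻¹`. [cite: KumarSaraf2017, Lemma 8.5] -/
theorem Lsum_le' (site : Fin r → Fin n) {x ε : ℝ} (hx0 : 0 ≤ x) (hx1 : x < 1)
    (hθ2 : 2 ≤ (1 - x)⁻¹) (hθ4 : (1 - x)⁻¹ ≤ 4) (hε0 : 0 < ε) (hε1 : ε ≤ 1)
    (hcond : 10 ≤ ε ^ 2 * (1 - x)⁻¹ ^ t) :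
    Lsum t site x ≤ (1 - x) ^ (n - r) * ((1 - x)⁻¹ * (1 + ε)) ^ (n + t) :=
  (Lsum_le site hx0 hx1).trans (mul_le_mul_of_nonneg_left
    (F_le' hθ2 hθ4 hε0 hε1 t hcond (n + t)) (pow_nonneg (by linarith) _))

end SlidingWindow

end Literature.Computability.AlgebraicComplexity
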